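import Summits.ValiantsHypothesis.ValiantsHypothesis.Theorems.DivisionGapPerDivisionHardStubPairPlacementAux

/-!
# Crux `DivisionGap.PerDivisionHard` (stmt-ValiantsHypothesis-5065), line `pair-descent-jss-endpoint` —
stub `stub_pairPlacement`: placing the block arsenal against binomial atoms, by counting

`stub_pairPlacement`: for all `d` there are `e n₀` such that for `n ≥ n₀`, given at most
`2^{n/(log₂ n+e)^e}` nonzero torus-homogeneous atoms `F_β` with `≤ 2` monomials and pairwise
non-proportional differences, a nonzero torus-homogeneous expression
`h = Σ_{l ∈ L} a_l · x^{C_l} · ∏_β F_β^{μ_l β}` with `|L| ≤ 2`, and two cells `ep, em`, some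
placement `eR eC` of `G(b,k) ⊕ M₀` (`b ≥ (log₂ n + d)^d`, `k ≥ 1`) keeps `ep, em` outside its face
`G = placedBlock eR eC` and satisfies (H1) the two monomials of every binomial atom differ off `G`,
(H2) two distinct binomial atoms are non-parallel off `G`, (H3) for two terms all of whose
separating atoms are monomials the vector `V_{l₁ l₂}` vanishes or is visible off `G`.

Proof: placement by counting with long subdivision paths, as in `stub_subexpRigid`
(`Theorems/DivisionGapPerDivisionHardStubSubexpRigid.lean`): `L = log₂ n`,
`q = (L + d + 1)^{d+1}`, `b = q`, `k = n/(4q²)`, `N = q + q²k` corner rows, `t₀ = 4k + 2`,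
`e = 2d + 4`, `n ≥ 16q³`.  The BAD VECTORS are (i) the differences `f - f'` of two monomials of an
atom, (ii) the cross combinations `(g - g') e₀ • (f - f') - (f - f') e₀ • (g - g')` over pairs of
atoms and cells `e₀`, (iii) the differences `a_{l₁} - a_{l₂}` of the term exponents
`a_l = C_l + Σ_β μ_l β • f_β` (one monomial `f_β` per atom); at most
`4|I| + 16 n²|I|² + 4 ≤ 2^{t₀}` of them (`count_bound`), all with vanishing margins (torus
homogeneity of the atoms, resp. of `h`, whose support contains every `a_l` over `ℝ≥0`).  Some
`N`-set `R` of rows contains no large bad row set (`exists_goodSubset`, `count_lt`); the core and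
internal row labels go to `R` (`exists_blockEquiv`), the column labels keep `ep, em` outside the
face (`exists_colEquiv_avoiding`).  A bad vector vanishing off `G` is then zero (`rigid_of_rows`):
this is (H1) and (H3) directly, and (H2) after evaluating `i • (f - f') = j • (g - g')` at a cell
`e₀ ∉ G` with `f e₀ ≠ f' e₀` (the cross combination vanishes off `G`, hence everywhere,
contradicting non-proportionality).
-/

noncomputable section

-- `Summit.ValiantsHypothesis.ValiantsHypothesis.…` is the tree's mandated single-conjunct layout
-- (Sub = Summit), so the duplicated namespace component is intended.
set_option linter.dupNamespace false

namespace Summit.ValiantsHypothesis.ValiantsHypothesis.Theorems.DivisionGapPerDivisionHard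

open MvPolynomial Literature.Computability.AlgebraicComplexity
open Summit.ValiantsHypothesis.ValiantsHypothesis.Theorems.ZeroOneTransfer.Negative
open scoped NNReal

/-- **`stub_pairPlacement` (placement of the block arsenal for the pair-flip branch of line
`pair-descent-jss-endpoint`).**  For every `d` there are `e, n₀` such that for `n ≥ n₀`: given at
most `2^{n/(log₂ n+e)^e}` nonzero torus-homogeneous atoms with `≤ 2` monomials and pairwise
non-proportional differences, a nonzero torus-homogeneous expression with at most two terms over
them, and two cells `ep, em`, some placement `eR eC` of `G(b,k) ⊕ M₀` (`b ≥ (log₂ n+d)^d`,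
`k ≥ 1`) has `ep, em` outside its face `G` and satisfies (H1) the two monomials of every binomial
atom differ off `G`, (H2) any two distinct binomial atoms are non-parallel off `G`, (H3) for every
two terms on which all separating atoms are monomials, the vector `V_{l₁l₂}` is `0` or does not
vanish off `G`.  Placement by counting (`exists_goodSubset`, `count_lt`, `k = n/(4q²)` as in
`stub_subexpRigid`) against the row sets of the bad vectors, girth substitute `rigid_of_rows`,
column labelling `exists_colEquiv_avoiding`. [folklore] -/
theorem stub_pairPlacement :
    ∀ d : ℕ, ∃ e n₀ : ℕ, ∀ n ≥ n₀, ∀ (ι κ : Type) (I : Finset ι) (L : Finset κ)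
      (F : ι → MvPolynomial (Fin n × Fin n) ℝ≥0) (a : κ → ℝ≥0) (C : κ → (Fin n × Fin n) →₀ ℕ)
      (μ : κ → ι → ℕ) (ep em : Fin n × Fin n),
      (∀ β ∈ I, F β ≠ 0 ∧ (F β).support.card ≤ 2 ∧ IsTorusHomogeneous (F β)) →
      I.card ≤ 2 ^ (n / (Nat.log 2 n + e) ^ e) → L.card ≤ 2 → (∀ l ∈ L, a l ≠ 0) →
      (∀ β ∈ I, ∀ β' ∈ I, β ≠ β' → ∀ f ∈ (F β).support, ∀ f' ∈ (F β).support, f ≠ f' →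
        ∀ g ∈ (F β').support, ∀ g' ∈ (F β').support, g ≠ g' → ∀ i j : ℤ, (i ≠ 0 ∨ j ≠ 0) →
          ∃ e₀ : Fin n × Fin n, i * ((f e₀ : ℤ) - f' e₀) ≠ j * ((g e₀ : ℤ) - g' e₀)) →
      (∑ l ∈ L, a l • (monomial (C l) (1 : ℝ≥0) * ∏ β ∈ I, F β ^ μ l β)) ≠ 0 →
      IsTorusHomogeneous (∑ l ∈ L, a l • (monomial (C l) (1 : ℝ≥0) * ∏ β ∈ I, F β ^ μ l β)) →
      ∃ (b k m : ℕ) (eR eC : BlockV b k m ≃ Fin n), (Nat.log 2 n + d) ^ d ≤ b ∧ 0 < k ∧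
        ep ∉ placedBlock eR eC ∧ em ∉ placedBlock eR eC ∧
        (∀ β ∈ I, ∀ f ∈ (F β).support, ∀ f' ∈ (F β).support, f ≠ f' →
          ∃ e ∉ placedBlock eR eC, f e ≠ f' e) ∧
        (∀ β ∈ I, ∀ β' ∈ I, β ≠ β' → ∀ f ∈ (F β).support, ∀ f' ∈ (F β).support, f ≠ f' →
          ∀ g ∈ (F β').support, ∀ g' ∈ (F β').support, g ≠ g' → ∀ i j : ℤ, (i ≠ 0 ∨ j ≠ 0) →
            ∃ e ∉ placedBlock eR eC, i * ((f e : ℤ) - f' e) ≠ j * ((g e : ℤ) - g' e)) ∧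
        (∀ l₁ ∈ L, ∀ l₂ ∈ L, (∀ β ∈ I, μ l₁ β ≠ μ l₂ β → (F β).support.card = 1) →
          (∀ e, (C l₁ e : ℤ) - C l₂ e +
              ∑ β ∈ I, ((μ l₁ β : ℤ) - μ l₂ β) * ∑ f ∈ (F β).support, (f e : ℤ) = 0) ∨
          ∃ e ∉ placedBlock eR eC, (C l₁ e : ℤ) - C l₂ e +
              ∑ β ∈ I, ((μ l₁ β : ℤ) - μ l₂ β) * ∑ f ∈ (F β).support, (f e : ℤ) ≠ 0) := by
  intro d
  obtain ⟨L₀, hL₀⟩ := growth d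
  refine ⟨2 * d + 4, 2 ^ (L₀ + 1), fun n hn ι κ I L F a C μ ep em hF hI hL ha hnp _ htor => ?_⟩
  -- the parameters (as in `stub_subexpRigid`)
  have hn0 : n ≠ 0 := by
    have : 1 ≤ 2 ^ (L₀ + 1) := Nat.one_le_two_pow
    omega
  have hLL₀ : L₀ + 1 ≤ Nat.log 2 n := Nat.le_log_of_pow_le one_lt_two hn
  have h2L : 2 ^ Nat.log 2 n ≤ n := Nat.pow_log_le_self 2 hn0
  have hn2 : n < 2 ^ (Nat.log 2 n + 1) := Nat.lt_pow_succ_log_self one_lt_two n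
  have hq16 := hL₀ (Nat.log 2 n) (by omega)
  have he := four_mul_sq_le_pow (Nat.log 2 n) d
  set lg := Nat.log 2 n
  have hy : 2 ≤ lg + d + 1 := by omega
  have hdq : (lg + d) ^ d ≤ (lg + d + 1) ^ (d + 1) :=
    (Nat.pow_le_pow_left (by omega) d).trans (Nat.pow_le_pow_right (by omega) (by omega))
  have hq2 : 2 ≤ (lg + d + 1) ^ (d + 1) :=
    (Nat.le_self_pow (Nat.succ_ne_zero _) 2).trans (Nat.pow_le_pow_left hy _)
  have hqL : lg + 1 ≤ (lg + d + 1) ^ (d + 1) :=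
    le_trans (by omega) (Nat.le_self_pow (Nat.succ_ne_zero d) (lg + d + 1))
  set q := (lg + d + 1) ^ (d + 1)
  have hqq : 4 ≤ q * q := Nat.mul_le_mul hq2 hq2
  have h2q : 2 * q ≤ q * q := Nat.mul_le_mul_right q hq2
  have hq0 : 0 < q := by omega
  have hqqq : q * q ≤ q * (q * q) := Nat.mul_le_mul_left q (Nat.le_mul_of_pos_left q hq0)
  -- the subdivision length `k = n / (4q²)`
  have h4qq : 0 < 4 * (q * q) := by omega
  have hk : 0 < n / (4 * (q * q)) := Nat.div_pos (by omega) h4qq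
  have hX : 4 * (q * (q * (n / (4 * (q * q))))) ≤ n :=
    calc 4 * (q * (q * (n / (4 * (q * q))))) = n / (4 * (q * q)) * (4 * (q * q)) := by ring
      _ ≤ n := Nat.div_mul_le_self n (4 * (q * q))
  have hke : n / (lg + (2 * d + 4)) ^ (2 * d + 4) ≤ n / (4 * (q * q)) :=
    Nat.div_le_div_left he h4qq
  have h4qk : 4 * q ≤ n / (4 * (q * q)) :=
    (Nat.le_div_iff_mul_le h4qq).mpr
      (calc 4 * q * (4 * (q * q)) = 16 * (q * (q * q)) := by ring
        _ ≤ n := hq16.trans h2L)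
  set k := n / (4 * (q * q))
  have h4k : 4 * k ≤ q * (q * k) := by
    rw [← Nat.mul_assoc]
    exact Nat.mul_le_mul_right k hqq
  have h16 : 16 * (n * n) ≤ 2 ^ (2 * k) :=
    calc 16 * (n * n) ≤ 16 * (2 ^ (lg + 1) * 2 ^ (lg + 1)) :=
          Nat.mul_le_mul_left 16 (Nat.mul_le_mul hn2.le hn2.le)
      _ = 2 ^ (2 * lg + 6) := by
          rw [show (16 : ℕ) = 2 ^ 4 by norm_num, ← pow_add, ← pow_add]; ring_nf
      _ ≤ 2 ^ (2 * k) := Nat.pow_le_pow_right two_pos (by omega)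
  have hIk : I.card ≤ 2 ^ k := hI.trans (Nat.pow_le_pow_right two_pos hke)
  -- one monomial per atom; the exponent `aL l` of the term `l` is a monomial of `h`
  have hch : ∀ β, ∃ f : (Fin n × Fin n) →₀ ℕ, β ∈ I → f ∈ (F β).support := fun β => by
    by_cases hβ : β ∈ I
    · obtain ⟨f, hf⟩ := support_nonempty.mpr (hF β hβ).1
      exact ⟨f, fun _ => hf⟩
    · exact ⟨0, fun h => absurd h hβ⟩
  choose fβ hfβ using hch
  set aL : κ → (Fin n × Fin n) →₀ ℕ := fun l => C l + ∑ β ∈ I, μ l β • fβ β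
  have haL : ∀ l ∈ L, aL l ∈
      (∑ l ∈ L, a l • (monomial (C l) (1 : ℝ≥0) * ∏ β ∈ I, F β ^ μ l β)).support :=
    fun l hl => support_subset_support_finset_sum L
      (fun l => a l • (monomial (C l) (1 : ℝ≥0) * ∏ β ∈ I, F β ^ μ l β)) hl
      (add_sum_nsmul_mem_support I F fβ (μ l) hfβ (ha l hl) (C l))
  -- the bad vectors: (i) atom differences, (ii) cross combinations, (iii) term differences
  set T : (Fin n × Fin n → ℤ) → Finset (Fin n) := fun D =>
    Finset.univ.filter fun r => ∃ c, D (r, c) ≠ 0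
  set V₁ : Finset (Fin n × Fin n → ℤ) := I.biUnion fun β =>
    ((F β).support ×ˢ (F β).support).image fun p e => (p.1 e : ℤ) - p.2 e
  set V₂ : Finset (Fin n × Fin n → ℤ) := (I ×ˢ I).biUnion fun ββ =>
    (((F ββ.1).support ×ˢ (F ββ.1).support) ×ˢ (((F ββ.2).support ×ˢ (F ββ.2).support) ×ˢ
      (Finset.univ : Finset (Fin n × Fin n)))).image fun x e =>
      ((x.2.1.1 x.2.2 : ℤ) - x.2.1.2 x.2.2) * ((x.1.1 e : ℤ) - x.1.2 e) -
        ((x.1.1 x.2.2 : ℤ) - x.1.2 x.2.2) * ((x.2.1.1 e : ℤ) - x.2.1.2 e)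
  set V₃ : Finset (Fin n × Fin n → ℤ) := (L ×ˢ L).image fun p e => (aL p.1 e : ℤ) - aL p.2 e
  set P := (V₁ ∪ V₂ ∪ V₃).filter fun D => 4 * k + 2 ≤ (T D).card
  have hsupp : ∀ β ∈ I, (F β).support.card * (F β).support.card ≤ 4 := fun β hβ =>
    Nat.mul_le_mul (hF β hβ).2.1 (hF β hβ).2.1
  have hV₁c : V₁.card ≤ I.card * 4 :=
    Finset.card_biUnion_le.trans ((Finset.sum_le_sum (g := fun _ => 4) fun β hβ =>
      Finset.card_image_le.trans (by rw [Finset.card_product]; exact hsupp β hβ)).trans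
      (by rw [Finset.sum_const, smul_eq_mul]))
  have hV₂c : V₂.card ≤ I.card * I.card * (4 * (4 * (n * n))) :=
    Finset.card_biUnion_le.trans ((Finset.sum_le_sum (g := fun _ => 4 * (4 * (n * n)))
      fun ββ hββ => Finset.card_image_le.trans (by
        obtain ⟨h1, h2⟩ := Finset.mem_product.mp hββ
        simp only [Finset.card_product, Finset.card_univ, Fintype.card_prod, Fintype.card_fin]
        exact Nat.mul_le_mul (hsupp _ h1) (Nat.mul_le_mul (hsupp _ h2) le_rfl))).trans
      (by rw [Finset.sum_const, smul_eq_mul, Finset.card_product]))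
  have hV₃c : V₃.card ≤ 2 * 2 :=
    Finset.card_image_le.trans (by rw [Finset.card_product]; exact Nat.mul_le_mul hL hL)
  have hPcard : P.card ≤ 2 ^ (4 * k + 2) :=
    calc P.card ≤ (V₁ ∪ V₂ ∪ V₃).card := Finset.card_filter_le _ _
      _ ≤ V₁.card + V₂.card + V₃.card :=
          (Finset.card_union_le _ _).trans (Nat.add_le_add_right (Finset.card_union_le _ _) _)
      _ ≤ I.card * 4 + I.card * I.card * (4 * (4 * (n * n))) + 2 * 2 :=
          Nat.add_le_add (Nat.add_le_add hV₁c hV₂c) hV₃c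
      _ ≤ 2 ^ (4 * k + 2) := count_bound hk h16 hIk
  -- a good set of `N = q + q²k` corner rows, the row labelling, the column labelling
  obtain ⟨R, hRcard, hRgood⟩ := exists_goodSubset P T (q + q * (q * k)) (4 * k + 2)
    (fun p hp => (Finset.mem_filter.mp hp).2)
    (by rw [Fintype.card_fin]; exact count_lt (by omega) (by omega) hPcard (by omega))
  obtain ⟨eR, heR₁, heR₂⟩ :=
    exists_blockEquiv R q k (n - (q + q * (q * k))) hRcard (by rw [hRcard])
  obtain ⟨eC, hep, hem⟩ := exists_colEquiv_avoiding eR (by omega) ep em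
  set G := placedBlock eR eC
  -- rigidity: a bad vector with vanishing margins that vanishes off `G` is zero
  have hrigid : ∀ D ∈ V₁ ∪ V₂ ∪ V₃, (∀ r, ∑ c, D (r, c) = 0) → (∀ c, ∑ r, D (r, c) = 0) →
      (∀ e ∉ G, D e = 0) → ∀ e, D e = 0 := fun D hD hrow hcol hoff =>
    rigid_of_rows eR eC hk R heR₁ heR₂
      (fun hcard => hRgood D (Finset.mem_filter.mpr ⟨hD, hcard⟩)) hrow hcol hoff
  -- the margins of atom differences vanish (the atoms are torus-homogeneous)
  have hmarg : ∀ β ∈ I, ∀ f ∈ (F β).support, ∀ f' ∈ (F β).support,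
      (∀ r, ∑ c, ((f (r, c) : ℤ) - f' (r, c)) = 0) ∧
        ∀ c, ∑ r, ((f (r, c) : ℤ) - f' (r, c)) = 0 := by
    intro β hβ f hf f' hf'
    obtain ⟨r₀, c₀, hrc⟩ := (hF β hβ).2.2
    exact sum_diff_eq_zero ((hrc f hf).1.trans (hrc f' hf').1.symm)
      ((hrc f hf).2.trans (hrc f' hf').2.symm)
  -- (H1) the two monomials of a binomial atom differ off `G`
  have H1 : ∀ β ∈ I, ∀ f ∈ (F β).support, ∀ f' ∈ (F β).support, f ≠ f' →
      ∃ e ∉ G, f e ≠ f' e := by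
    intro β hβ f hf f' hf' hne
    by_contra hall
    push Not at hall
    obtain ⟨hrow, hcol⟩ := hmarg β hβ f hf f' hf'
    have hmem : (fun e => (f e : ℤ) - f' e) ∈ V₁ ∪ V₂ ∪ V₃ :=
      Finset.mem_union_left _ (Finset.mem_union_left _ (Finset.mem_biUnion.mpr
        ⟨β, hβ, Finset.mem_image.mpr ⟨(f, f'), Finset.mk_mem_product hf hf', rfl⟩⟩))
    have h0 := hrigid _ hmem hrow hcol fun e he => by simp only [hall e he, sub_self]
    exact hne (Finsupp.ext fun e => by exact_mod_cast sub_eq_zero.mp (h0 e))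
  refine ⟨q, k, n - (q + q * (q * k)), eR, eC, hdq, hk, hep, hem, H1, ?_, ?_⟩
  · -- (H2) two distinct binomial atoms are non-parallel off `G`
    intro β hβ β' hβ' hββ' f hf f' hf' hff' g hg g' hg' hgg' i j hij
    by_contra hall
    push Not at hall
    obtain ⟨e₀, he₀, hA⟩ := H1 β hβ f hf f' hf' hff'
    obtain ⟨e₁, he₁, hA'⟩ := H1 β' hβ' g hg g' hg' hgg'
    set A : ℤ := (f e₀ : ℤ) - f' e₀
    set B : ℤ := (g e₀ : ℤ) - g' e₀
    have hA0 : A ≠ 0 := fun h => hA (by exact_mod_cast sub_eq_zero.mp h)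
    have hA'0 : (g e₁ : ℤ) - g' e₁ ≠ 0 := fun h => hA' (by exact_mod_cast sub_eq_zero.mp h)
    have h₀ : i * A = j * B := hall e₀ he₀
    have h₁ : i * ((f e₁ : ℤ) - f' e₁) = j * ((g e₁ : ℤ) - g' e₁) := hall e₁ he₁
    have hi : i ≠ 0 := by
      rintro rfl
      have hj : j ≠ 0 := hij.resolve_left fun h => h rfl
      rw [zero_mul] at h₁
      exact hA'0 ((mul_eq_zero.mp h₁.symm).resolve_left hj)
    have hj : j ≠ 0 := by
      rintro rfl
      rw [zero_mul] at h₀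
      exact hA0 ((mul_eq_zero.mp h₀).resolve_left hi)
    -- the cross combination `B • (f - f') - A • (g - g')` vanishes off `G`, hence everywhere
    set D : Fin n × Fin n → ℤ := fun e => B * ((f e : ℤ) - f' e) - A * ((g e : ℤ) - g' e)
    have hoff : ∀ e ∉ G, D e = 0 := fun e he => by
      have h₂ : i * ((f e : ℤ) - f' e) = j * ((g e : ℤ) - g' e) := hall e he
      have : i * j * (B * ((f e : ℤ) - f' e) - A * ((g e : ℤ) - g' e)) = 0 := by
        linear_combination (j * B) * h₂ - (j * ((g e : ℤ) - g' e)) * h₀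
      exact (mul_eq_zero.mp this).resolve_left (mul_ne_zero hi hj)
    obtain ⟨hrow, hcol⟩ := comb_margins (u := fun e => (f e : ℤ) - f' e)
      (v := fun e => (g e : ℤ) - g' e) A B (hmarg β hβ f hf f' hf') (hmarg β' hβ' g hg g' hg')
    have hmem : D ∈ V₁ ∪ V₂ ∪ V₃ :=
      Finset.mem_union_left _ (Finset.mem_union_right _ (Finset.mem_biUnion.mpr
        ⟨(β, β'), Finset.mk_mem_product hβ hβ', Finset.mem_image.mpr
          ⟨((f, f'), ((g, g'), e₀)), by
            simp only [Finset.mem_product, Finset.mem_univ, and_true]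
            exact ⟨⟨hf, hf'⟩, hg, hg'⟩, rfl⟩⟩))
    have h0 := hrigid _ hmem hrow hcol hoff
    -- ... contradicting non-proportionality with `(i, j) := ((g - g') e₀, (f - f') e₀)`
    obtain ⟨e, he⟩ := hnp β hβ β' hβ' hββ' f hf f' hf' hff' g hg g' hg' hgg' B A (Or.inr hA0)
    exact he (sub_eq_zero.mp (h0 e))
  · -- (H3) `V_{l₁ l₂} = aL l₁ - aL l₂` vanishes or is visible off `G`
    intro l₁ hl₁ l₂ hl₂ hsep
    have hV := sum_term_eq_sub I F fβ hfβ C μ hsep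
    obtain ⟨r₀, c₀, hrc⟩ := htor
    obtain ⟨hrow, hcol⟩ := sum_diff_eq_zero
      ((hrc _ (haL l₁ hl₁)).1.trans (hrc _ (haL l₂ hl₂)).1.symm)
      ((hrc _ (haL l₁ hl₁)).2.trans (hrc _ (haL l₂ hl₂)).2.symm)
    have hmem : (fun e => (aL l₁ e : ℤ) - aL l₂ e) ∈ V₁ ∪ V₂ ∪ V₃ :=
      Finset.mem_union_right _
        (Finset.mem_image.mpr ⟨(l₁, l₂), Finset.mk_mem_product hl₁ hl₂, rfl⟩)
    by_cases hoff : ∀ e ∉ G, (aL l₁ e : ℤ) - aL l₂ e = 0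
    · refine Or.inl fun e => ?_
      rw [hV]
      exact hrigid _ hmem hrow hcol hoff e
    · push Not at hoff
      obtain ⟨e, he, hne⟩ := hoff
      exact Or.inr ⟨e, he, by rwa [hV]⟩

end Summit.ValiantsHypothesis.ValiantsHypothesis.Theorems.DivisionGapPerDivisionHard

end
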